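import Mathlib
import Summits.Ventures.PercRepro.PuncturedLYMFibrationNodeFamily
import Summits.Ventures.PercRepro.PuncturedLYMFibrationNodeIFR
import Summits.Ventures.PercRepro.PuncturedLYMIFR

/-!
# PercRepro — THE FIRST FAMILY OF THE NODE LEMMA FOR THE COUNTS OF A FAMILY, WITH THE COUNT LEMMAS DISCHARGED
(p10, gen 38)

At a node of the fibration recursion fibrated over a member of size `m ≤ ℓ`, with the other members `𝒞` on the
remaining ground set `S` (pairwise disjoint, nonempty, no two in a common `(ℓ+1)`-subset), the FIRST family of layer
inequalities `0 ≤ Hn a` follows from the fibre-0 density condition `0 ≤ en 0`, the totals, and the EXPLICIT SLOPE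
INEQUALITY at every layer step — the two count-only hypotheses of `NodeArith.first_family_of_ifr` being theorems:
the log-concavity of the survival fraction (`ifr_rowsOf`) and the ratio lemma (`step_ratio`).  Together with
`second_family_of_family`, the node lemma for the counts of a pairwise disjoint family is a theorem whose only
hypotheses are the node's explicit inequalities (ii), (i*), (ii′) and the slope inequality.  Nothing here asserts (SP).
-/

namespace PercRepro.PuncturedLYM.Split

open Finset NodeArith

variable {α : Type} [DecidableEq α]

/-- **THE FIRST FAMILY FOR THE COUNTS OF A FAMILY.** -/
theorem first_family_of_counts {S : Finset α} {𝒞 : Finset (Finset α)} {ℓ m : ℕ} {ρ θ NC : ℚ}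
    (hsub : ∀ C ∈ 𝒞, C ⊆ S) (hpair : ∀ C ∈ 𝒞, ∀ C' ∈ 𝒞, C ≠ C' → Disjoint C C') (hne : ∀ C ∈ 𝒞, C.Nonempty)
    (hone : ∀ Y ⊆ S, Y.card ≤ ℓ + 1 → ∀ C ∈ 𝒞, ∀ C' ∈ 𝒞, C ⊆ Y → C' ⊆ Y → C = C')
    (hmℓ : m ≤ ℓ) (hℓ : ℓ + 1 ≤ S.card)
    (hr : ∀ c, c < m → 0 < rFam S 𝒞 (ℓ - c)) (hr' : ∀ c, c < m → 0 < rFam S 𝒞 (ℓ - c + 1))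
    (hslope : ∀ s, ℓ - m + 1 ≤ s → s + 1 < ℓ + 1 →
      qFam S 𝒞 (s + 1) * rFam S 𝒞 s * (((s : ℚ) + 2) * ((S.card : ℚ) - s))
        - qFam S 𝒞 s * rFam S 𝒞 (s + 1) * (((s : ℚ) + 1) * ((S.card : ℚ) - s - 1))
      ≤ ρ * ((S.card : ℚ) + 1) * (rFam S 𝒞 s * rFam S 𝒞 (s + 1)))
    (h0 : 0 ≤ en m ℓ ρ θ (rFam S 𝒞) (qFam S 𝒞) 0)
    (htot : Hn m ℓ ρ θ (rFam S 𝒞) (qFam S 𝒞) m = NC) (hNC : 0 ≤ NC) :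
    ∀ a, a ≤ m → 0 ≤ Hn m ℓ ρ θ (rFam S 𝒞) (qFam S 𝒞) a := by
  refine first_family_of_ifr (np := S.card) hmℓ hℓ hr hr' ?_ ?_ hslope h0 htot hNC
  · -- IFR of the counts
    intro s hs1 hs2
    have := ifr_rowsOf hsub hpair hne s (by omega)
    unfold rFam
    exact this
  · -- the ratio lemma at the step
    intro s hs1 hs2
    have := step_ratio (S := S) (𝒞 := 𝒞) (t := s) (fun Y hY hYc => hone Y hY (by omega))
    unfold rFam qFam
    exact this

end PercRepro.PuncturedLYM.Split
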